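import Summits.BirchSwinnertonDyer.Rank1Residual.AdditivePotMult.QuadraticBaseChangeTamagawaMultiplicative
import Summits.BirchSwinnertonDyer.Rank1Residual.AdditivePotMult.QuadraticTwistTamagawaMultiplicative
import Summits.BirchSwinnertonDyer.Rank1Residual.AdditivePotMult.QuadraticTwistTamagawaGood
import Summits.BirchSwinnertonDyer.Rank1Residual.AdditivePotMult.QuadraticBaseChangeTwistTransfer
import Summits.BirchSwinnertonDyer.Rank1Residual.AdditivePotMult.QuadraticTwistRamifiedTamagawaOdd
import Summits.BirchSwinnertonDyer.Rank1Residual.AdditivePotMult.QuadraticBaseChangeNormValuation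
import Summits.BirchSwinnertonDyer.Rank1Residual.X11b.TamagawaLocalLemmas
import Literature.NumberTheory.EllipticCurves.ComplexMultiplicationDeuringRamifiedProofs
import Literature.NumberTheory.QuadraticFields.KroneckerSplitting
import Mathlib.RingTheory.RamificationInertia.Ramification
import Mathlib.NumberTheory.NumberField.Discriminant.Different
import HarnessLib

/-!
# The splitting dictionary of a quadratic field and model transport, for the odd-Tamagawa identities
# (row T-MIL-ODD, FILE C-3a; seat n1011-p01 GEN 6)

HONEST FRAMING (cell `b2b-bsdres`, run/shared/lean/b2b/bsd-rank1-residual/, verbatim in every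
file): the goal of the cell is to DELETE the COMBINATION-SHAPED residual classes of the
Birch–Swinnerton-Dyer formula for ALL analytic-rank `≤ 1` elliptic curves over `ℚ` — "full BSD
formula for every rank `≤ 1` curve in class `C`" assembled STRICTLY from published theorems — so
that the rank-`≤ 1` remainder becomes exactly the CONSTRUCTION-SHAPED classes, which are TYPED
(missing-input `Prop`s), NOT attempted. This is not "finishing BSD". Sub-classes X3♯(M) / X4(M)
(additive, potentially multiplicative prime; base-change-and-descend): a RESEARCH ROUTE; they stay
CONSTRUCTION-SHAPED; nothing is booked by this file; no mark / label moved. THEOREMS ONLY: no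
definition, no named fact, no `sorry`.

## What and why (row T-MIL-ODD, `cells/n1011/skel/T-MIL-ODD.md` §1 and §6)

The per-place odd-Tamagawa identities (T) of FILE C-3b are indexed by the three cases of the
tree's `placesOver_trichotomy_of_finrank_eq_two` (split / inert / ramified, in the currency
`{w : w ∩ 𝓞 ℚ = v}`, `e = w.asIdeal.ramificationIdx (𝓞 ℚ)`, `f = w.asIdeal.inertiaDeg (𝓞 ℚ)`),
while the stage-A twist lemmas are indexed by the arithmetic of `d = d_K` at `ℓ` (`ℓ ∤ d` with `d` a
square / a non-square mod `ℓ`; `ℓ ∥ d`). This file is the DICTIONARY between the two, for a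
quadratic `K` at an ODD prime `ℓ`:

* `not_dvd_discr_of_forall_ramificationIdx_eq_one` (any number field `K`) — **Dedekind's
  discriminant theorem, converse direction, in the place currency**: if every place above `v ↔ ℓ`
  has `e = 1` over `𝓞 ℚ` then `ℓ ∤ d_K` (Mathlib `NumberField.not_dvd_discr_iff_forall_mem` over
  `ℤ`, after `Ideal.ramificationIdx_eq_one_iff` and the descent `𝓞 ℚ → ℤ` of
  `Algebra.IsUnramifiedAt` along `FormallyUnramified.comp`); `not_dvd_discr_of_fibre_eq_singleton`;
* `natCast_dvd_discr_of_ramificationIdx_eq_two` — `e = 2 ⇒ ℓ ∣ d_K` (tree, Deuring file);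
* `not_dvd_and_not_isSquare_discr_of_inert` / `not_dvd_and_isSquare_discr_of_split` — inert / split
  at odd `ℓ` ⇔ `ℓ ∤ d_K` and `d_K` a non-square / a square mod `ℓ` (tree
  `KroneckerSplitting.ncard_primesOver_eq_two_iff_legendreSym` + x11b `ncard_primesOver_span_eq`);
* `not_sq_dvd_of_squarefree` — `ℓ ∥ d` for squarefree `d`;
* `localTamagawaNumber_eq_of_variableChange_eq` — `c_v(C • X) = c_v(X)` over `ℚ` (reading the
  stage-A twist lemmas, stated on the equation `W.quadraticTwist d`, on any model `W_d`);
* `exists_sq_eq_discr` — `√d_K ∈ K` (the input of stage A-4K's transfer lemmas).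

In print: Neukirch, *Algebraic Number Theory* I (8.5) (decomposition in quadratic fields), III
(2.12) (Dedekind); Marcus Ch. 3 Thm. 25. HONEST LIMITS: TOOL lemmas (field theory and model
transport only); closes no class; discharges no fact by itself.
-/

noncomputable section

open scoped Classical NumberField

open WeierstrassCurve NumberField IsDedekindDomain Rat.HeightOneSpectrum WithZero
  Literature.NumberTheory.EllipticCurves
  Summit.BirchSwinnertonDyer.Rank1Residual.Additive

namespace Summit.BirchSwinnertonDyer.Rank1Residual.AdditivePotMult

/-! ## §0 The splitting dictionary of a quadratic field, in the place currency -/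

section Dictionary

variable (K : Type*) [Field K] [NumberField K] (v : HeightOneSpectrum (𝓞 ℚ))

/-- **Dedekind's discriminant theorem, converse direction, in the place currency**: if every place
`w` of `K` above the place `v ↔ ℓ` of `ℚ` has ramification index `e(w|v) = 1` over `𝓞 ℚ`, then
`ℓ ∤ d_K`. Mathlib's `NumberField.not_dvd_discr_iff_forall_mem` (over `ℤ`) after descending
`Algebra.IsUnramifiedAt (𝓞 ℚ) w` (from `e = 1`, `Ideal.ramificationIdx_eq_one_iff`) to `ℤ` along the
surjection `ℤ → 𝓞 ℚ` (`FormallyUnramified.of_surjective`, `FormallyUnramified.comp`).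
[cite: NeukirchANT1999, Ch. III §2, Thm. (2.6) and Cor. (2.12)] -/
theorem not_dvd_discr_of_forall_ramificationIdx_eq_one
    (hall : ∀ w : HeightOneSpectrum (𝓞 K), w.under (𝓞 ℚ) = v →
      w.asIdeal.ramificationIdx (𝓞 ℚ) = 1) :
    ¬ ((primesEquiv v : ℕ) : ℤ) ∣ NumberField.discr K := by
  set ℓ : ℕ := (primesEquiv v : ℕ) with hℓdef
  have hℓ : ℓ.Prime := (primesEquiv v).2
  have hp : Prime (ℓ : ℤ) := Nat.prime_iff_prime_int.mp hℓ
  have hsurj : Function.Surjective (Algebra.ofId ℤ (𝓞 ℚ)) := Rat.int_algebraMap_surjective (𝓞 ℚ)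
  haveI : Algebra.FormallyUnramified ℤ (𝓞 ℚ) :=
    Algebra.FormallyUnramified.of_surjective (Algebra.ofId ℤ (𝓞 ℚ)) hsurj
  refine (NumberField.not_dvd_discr_iff_forall_mem K (𝓞 K) hp).mpr ?_
  intro P hP hℓP
  have hP0 : P ≠ ⊥ := by
    intro h0
    rw [h0, Ideal.mem_bot] at hℓP
    exact hp.ne_zero (by exact_mod_cast hℓP)
  set w : HeightOneSpectrum (𝓞 K) := ⟨P, hP, hP0⟩ with hw
  have hmem : (ℓ : 𝓞 ℚ) ∈ (w.under (𝓞 ℚ)).asIdeal := by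
    rw [HeightOneSpectrum.under_asIdeal, Ideal.under_def, Ideal.mem_comap, map_natCast]
    exact_mod_cast hℓP
  have hv : v = (primesEquiv (R := 𝓞 ℚ)).symm ⟨ℓ, hℓ⟩ := by
    rw [Equiv.eq_symm_apply]; exact Subtype.ext rfl
  have hwv : w.under (𝓞 ℚ) = v := by
    rw [(natCast_mem_asIdeal_iff_eq_primesEquiv_symm _ hℓ).mp hmem, hv]
  haveI : Algebra.IsUnramifiedAt (𝓞 ℚ) w.asIdeal :=
    (Ideal.ramificationIdx_eq_one_iff).mp (hall w hwv)
  exact Algebra.FormallyUnramified.comp ℤ (𝓞 ℚ) (Localization.AtPrime w.asIdeal)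

/-- A single place above `v` with `e = 1` (the INERT case of the trichotomy) forces `ℓ ∤ d_K`.
[cite: NeukirchANT1999, Ch. III §2, Cor. (2.12)] -/
theorem not_dvd_discr_of_fibre_eq_singleton {w : HeightOneSpectrum (𝓞 K)}
    (hset : {w' : HeightOneSpectrum (𝓞 K) | w'.under (𝓞 ℚ) = v} = {w})
    (he : w.asIdeal.ramificationIdx (𝓞 ℚ) = 1) :
    ¬ ((primesEquiv v : ℕ) : ℤ) ∣ NumberField.discr K := by
  refine not_dvd_discr_of_forall_ramificationIdx_eq_one K v fun w' hw' => ?_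
  have h : w' ∈ ({w} : Set (HeightOneSpectrum (𝓞 K))) := by rw [← hset]; exact hw'
  rw [Set.mem_singleton_iff] at h
  rw [h, he]

/-- A place with `e = 2` lies over a prime dividing `d_K` (tree
`natGenerator_dvd_discr_of_ramificationIdx_eq_two`, Dedekind). [cite: NeukirchANT1999, Ch. III §2, Cor. (2.12)] -/
theorem natCast_dvd_discr_of_ramificationIdx_eq_two {w : HeightOneSpectrum (𝓞 K)}
    (hw : w.under (𝓞 ℚ) = v) (he : w.asIdeal.ramificationIdx (𝓞 ℚ) = 2) :
    ((primesEquiv v : ℕ) : ℤ) ∣ NumberField.discr K := by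
  have h := natGenerator_dvd_discr_of_ramificationIdx_eq_two K w he
  rw [hw] at h
  exact h

/-- Two places above `v` means two primes of `𝓞 K` over `(ℓ)` (x11b `ncard_primesOver_span_eq`).
[folklore] -/
theorem ncard_primesOver_eq_of_fibre_pair {w₁ w₂ : HeightOneSpectrum (𝓞 K)} (hne : w₁ ≠ w₂)
    (hset : {w : HeightOneSpectrum (𝓞 K) | w.under (𝓞 ℚ) = v} = {w₁, w₂}) :
    ((Ideal.span {((primesEquiv v : ℕ) : ℤ)}).primesOver (𝓞 K)).ncard = 2 := by
  rw [X11b.ncard_primesOver_span_eq K v, hset, Set.ncard_pair hne]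

/-- One place above `v` means one prime of `𝓞 K` over `(ℓ)` (x11b `ncard_primesOver_span_eq`).
[folklore] -/
theorem ncard_primesOver_eq_one_of_fibre_singleton {w : HeightOneSpectrum (𝓞 K)}
    (hset : {w' : HeightOneSpectrum (𝓞 K) | w'.under (𝓞 ℚ) = v} = {w}) :
    ((Ideal.span {((primesEquiv v : ℕ) : ℤ)}).primesOver (𝓞 K)).ncard = 1 := by
  rw [X11b.ncard_primesOver_span_eq K v, hset, Set.ncard_singleton]

variable {K} in
/-- **The INERT dictionary at an odd prime**: for `[K:ℚ] = 2`, a single place `w` above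
`v ↔ ℓ ≠ 2` with `e = 1` gives `ℓ ∤ d_K` and `d_K` a NON-square mod `ℓ` (decomposition law: `ℓ`
splits iff `(d_K/ℓ) = 1`, tree `KroneckerSplitting.ncard_primesOver_eq_two_iff_legendreSym`;
Mathlib `legendreSym.eq_neg_one_iff`). [cite: NeukirchANT1999, Ch. I, Prop. (8.5)] -/
theorem not_dvd_and_not_isSquare_discr_of_inert (h2 : Module.finrank ℚ K = 2)
    (hv2 : (primesEquiv v : ℕ) ≠ 2) {w : HeightOneSpectrum (𝓞 K)}
    (hset : {w' : HeightOneSpectrum (𝓞 K) | w'.under (𝓞 ℚ) = v} = {w})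
    (he : w.asIdeal.ramificationIdx (𝓞 ℚ) = 1) :
    ¬ ((primesEquiv v : ℕ) : ℤ) ∣ NumberField.discr K ∧
      ¬ IsSquare ((NumberField.discr K : ℤ) : ZMod (primesEquiv v : ℕ)) := by
  haveI hp : Fact (Nat.Prime (primesEquiv v : ℕ)) := ⟨(primesEquiv v).2⟩
  have hnd := not_dvd_discr_of_fibre_eq_singleton K v hset he
  refine ⟨hnd, ?_⟩
  have h0 : ((NumberField.discr K : ℤ) : ZMod (primesEquiv v : ℕ)) ≠ 0 := by
    rw [Ne, ZMod.intCast_zmod_eq_zero_iff_dvd]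
    exact_mod_cast hnd
  have hne1 : legendreSym (primesEquiv v : ℕ) (NumberField.discr K) ≠ 1 := by
    intro h1
    have h := (Literature.NumberTheory.QuadraticFields.Quadratic.ncard_primesOver_eq_two_iff_legendreSym
      h2 hv2).mpr h1
    rw [ncard_primesOver_eq_one_of_fibre_singleton K v hset] at h
    exact absurd h (by decide)
  exact (legendreSym.eq_neg_one_iff _).mp ((legendreSym.eq_neg_one_iff_not_one _ h0).mpr hne1)

variable {K} in
/-- **The SPLIT dictionary at an odd prime**: two places above `v ↔ ℓ ≠ 2` give `ℓ ∤ d_K` and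
`d_K` a square mod `ℓ` (`(d_K/ℓ) = 1`). [cite: NeukirchANT1999, Ch. I, Prop. (8.5)] -/
theorem not_dvd_and_isSquare_discr_of_split (h2 : Module.finrank ℚ K = 2)
    (hv2 : (primesEquiv v : ℕ) ≠ 2) {w₁ w₂ : HeightOneSpectrum (𝓞 K)} (hne : w₁ ≠ w₂)
    (hset : {w : HeightOneSpectrum (𝓞 K) | w.under (𝓞 ℚ) = v} = {w₁, w₂}) :
    ¬ ((primesEquiv v : ℕ) : ℤ) ∣ NumberField.discr K ∧
      IsSquare ((NumberField.discr K : ℤ) : ZMod (primesEquiv v : ℕ)) := by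
  haveI hp : Fact (Nat.Prime (primesEquiv v : ℕ)) := ⟨(primesEquiv v).2⟩
  have h1 : legendreSym (primesEquiv v : ℕ) (NumberField.discr K) = 1 :=
    (Literature.NumberTheory.QuadraticFields.Quadratic.ncard_primesOver_eq_two_iff_legendreSym
      h2 hv2).mp (ncard_primesOver_eq_of_fibre_pair K v hne hset)
  have h0 : ((NumberField.discr K : ℤ) : ZMod (primesEquiv v : ℕ)) ≠ 0 := fun h0 => by
    rw [(legendreSym.eq_zero_iff _ _).mpr h0] at h1
    exact zero_ne_one h1
  refine ⟨fun hdvd => h0 ?_, (legendreSym.eq_one_iff _ h0).mp h1⟩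
  rw [ZMod.intCast_zmod_eq_zero_iff_dvd]
  exact_mod_cast hdvd

/-- A squarefree integer is not divisible by the square of a prime (the `ℓ ∥ d` side
condition of the ramified-twist lemmas of stage A, for a squarefree `d_K`). [folklore] -/
theorem not_sq_dvd_of_squarefree {d : ℤ} (hd : Squarefree d) (ℓ : ℕ) (hℓ : ℓ.Prime) :
    ¬ ((ℓ : ℕ) : ℤ) ^ 2 ∣ d := by
  intro h
  rw [sq] at h
  have hu := hd _ h
  rw [Int.isUnit_iff_natAbs_eq, Int.natAbs_natCast] at hu
  exact hℓ.one_lt.ne' hu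

end Dictionary

/-! ## §1 Transport along models, and a square root of `d_K` in `K` -/

section Models

/-- `c_v(C • X) = c_v(X)` over `ℚ`: the local Tamagawa number of a model `W_d = C • X` is that of
`X` (tree `localTamagawaNumber_variableChange_holds` at the completion, Mathlib `map_variableChange`);
used to read the stage-A twist lemmas (stated on the equation `W.quadraticTwist d`) on any model
`W_d = C_d • W^{(d)}`. [cite: SilvermanAEC2009, VII.1 Prop. 1.3(b) with VII.6 (Ex. 7.6)] -/
theorem localTamagawaNumber_eq_of_variableChange_eq {X Wd : WeierstrassCurve ℚ} [X.IsElliptic]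
    {C : VariableChange ℚ} (hC : C • X = Wd) (v : HeightOneSpectrum (𝓞 ℚ)) :
    (Wd.baseChange (v.adicCompletion ℚ)).localTamagawaNumber (v.adicCompletionIntegers ℚ) =
      (X.baseChange (v.adicCompletion ℚ)).localTamagawaNumber (v.adicCompletionIntegers ℚ) := by
  haveI : (X.baseChange (v.adicCompletion ℚ)).IsElliptic := by rw [baseChange]; infer_instance
  rw [← hC, baseChange, ← map_variableChange]
  exact localTamagawaNumber_variableChange_holds (v.adicCompletionIntegers ℚ)
    (X.map (algebraMap ℚ (v.adicCompletion ℚ))) (C.map (algebraMap ℚ _))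

/-- **`√d_K ∈ K`**: a quadratic field contains a non-zero `θ` with `θ² = d_K` (`K = ℚ(θ₀)`,
`θ₀² = c`, tree `Quadratic.exists_sq_eq_algebraMap`, and `d_K = c q²`,
`NumberField.exists_discr_eq_mul_sq`; take `θ = q θ₀`) — the input `hθ` of stage A-4K's transfer
lemmas `…_baseChange_…_of_twist`. [folklore] -/
theorem exists_sq_eq_discr {K : Type} [Field K] [NumberField K] (h2 : Module.finrank ℚ K = 2) :
    ∃ θ : K, θ ≠ 0 ∧ θ ^ 2 = algebraMap ℚ K (NumberField.discr K : ℚ) := by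
  obtain ⟨θ, c, hθ, hc⟩ :=
    Literature.NumberTheory.QuadraticFields.Quadratic.exists_sq_eq_algebraMap (F := ℚ) (K := K) h2
  obtain ⟨q, hq, hd⟩ := NumberField.exists_discr_eq_mul_sq h2 hθ hc
  have hθ0 : θ ≠ 0 := by
    rintro rfl
    exact hθ ⟨0, by simp⟩
  refine ⟨θ * algebraMap ℚ K q, mul_ne_zero hθ0 (by simpa using hq), ?_⟩
  rw [mul_pow, hc, ← map_pow, ← map_mul, hd]

end Models

end Summit.BirchSwinnertonDyer.Rank1Residual.AdditivePotMult

end
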